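import Literature.Computability.AlgebraicComplexity.AndrewsForbes2022PartialsOfDetProofs
import HarnessLib

/-!
# Discharge of `AndrewsForbes2022_prop_5_3` and `AndrewsForbes2022_prop_5_3_charZero`:
# partial derivatives of bideterminants (Andrews–Forbes 2022, §5: Lemmas 5.1, 5.2, Prop. 5.3)
(cell val-lit, seat t22 on discharge duty; facts typed by t24 in
`AndrewsForbes2022DeterminantalIdeals.lean`)

R. Andrews, M. A. Forbes, *Ideals, determinants, and straightening: proving and using lower bounds
for polynomial ideals*, STOC 2022 / arXiv:2112.00792, §5 (pp. 29–30). HONEST FRAMING: classical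
commutative algebra about bideterminants; nothing here bears on `VP ≠ VNP` beyond discharging two
typed literature facts (Prop. 5.3 and its characteristic-zero clause).

## The printed proof and how it is followed

Let `(S | T) = ∏ₖ (S(k,•) | T(k,•))` be a nonzero bideterminant of width `r` (tree `bideterminant`,
`Bitableau.width`; nonzero ⟹ every row has distinct row indices and distinct column indices,
`injective_of_bideterminant_ne_zero`).

* **Product rule** (AF22 Lemma 2.16, used in the proof of Lemma 5.1): `∂/∂x^a (f g) =
  Σ_{b + c = a} ∂/∂x^b(f) · ∂/∂x^c(g)` — `mvHasseDeriv_mul`, read off from t24's Taylor morphism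
  `Lemma220.taylor` (an algebra map) and `Lemma220.coeff_taylor`.
* **Lemma 5.1 / Lemma 5.2** (p0029:L39–p0030:L40). The printed Lemma 5.2 produces, for a set of
  positions `P = {(r₁,c₁), …, (r_ℓ,c_ℓ)}` with distinct rows and distinct columns, exponents
  `dᵢ = ideg_{x_{rᵢ,cᵢ}}` and shows `(∏ᵢ ∂^{dᵢ}/∂x_{rᵢ,cᵢ}^{dᵢ}) (S|T) = ± (S'|T') ≠ 0` by iterating
  Lemma 5.1 (top Hasse derivative in one variable of a product of minors = product of the top
  derivatives of the factors, each `±` a complementary minor). As the proof of Lemma 5.1 shows,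
  `dᵢ = #{k : (rᵢ, cᵢ) ∈ S(k,•) × T(k,•)}`, and these counts are unchanged along the induction of
  Lemma 5.2 (removing `r₁` from a row does not affect membership of `r₂ ≠ r₁`). We therefore state the
  outcome of Lemmas 5.1+5.2 in closed form: with `a = Σₖ 𝟙_{P ∩ (S(k,•) × T(k,•))}` (`hasseIdx`),
  `∂/∂x^a (S|T) = ∏ₖ ∂/∂x^{𝟙_{P ∩ (S(k,•)×T(k,•))}} (S(k,•)|T(k,•))` (`mvHasseDeriv_hasseIdx_bideterminant`:
  in the product rule only one term survives, because a minor is multilinear —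
  `le_sqfree_rowGrid_of_mvHasseDeriv_ne_zero`, `le_cap_of_mvHasseDeriv_bideterminant_ne_zero`), and
  each factor is `±` a minor of the generic matrix, hence nonzero (`mvHasseDeriv_sqfree_rowMinor_ne_zero`: the
  partial matching extends to a permutation whose monomial carries coefficient `±1`). The
  characteristic-zero clause of Lemma 5.2 (`dᵢ = 1`) follows as printed from "partial derivatives
  commute": `∂/∂x^b ∘ ∂/∂x^c = binom(b+c, b) · ∂/∂x^{b+c}` (`mvHasseDeriv_mvHasseDeriv`) with an
  invertible integer scalar (`mvHasseDeriv_sqfree_bideterminant_ne_zero`).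
* **Proposition 5.3** (p0030:L45–L106): pick a row `k₀` of length `r` (the typed width is the
  maximal row length; the printed proof uses the first row of a partition shape — any longest row
  does), index the derivatives by pairs `(U, V)` of equinumerous subsets of its positions
  (`pairMatching`, matched in increasing order), and separate them by MULTIDEGREE: bideterminants
  are multihomogeneous for the row- and column-degree vectors (`rowDeg`, `colDeg`,
  `multideg_of_mem_support_bideterminant`), a Hasse derivative shifts the multidegree by that of its
  index (`add_mem_support_of_mem_support_mvHasseDeriv`), and the row-degree of the index recovers `U`,
  the column-degree recovers `V` (`mem_iff_rowDeg_hasseIdx_ne_zero`, `mem_iff_colDeg_hasseIdx_ne_zero`). Nonzero polynomials with pairwise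
  distinct multidegrees have pairwise disjoint supports, so they are linearly independent
  (`linearIndependent_of_support_disjoint`, `linearIndependent_hasseIdx_family`, `linearIndependent_sqfree_family`); there are `Σᵢ binom(r,i)² = binom(2r,r)` of them
  (`Nat.sum_range_choose_sq`), all inside `∂_{<∞}((S|T))`; in characteristic zero the first-order
  versions of order `|U| ≤ d` lie in `∂_{≤d}((S|T))`, `Σ_{i ≤ d} binom(r,i)²` of them.

## References

* [AndrewsForbes2022] R. Andrews, M. A. Forbes, *Ideals, determinants, and straightening*, STOC 2022;
  arXiv:2112.00792, §5: Lemma 5.1 (p. 29), Lemma 5.2 (pp. 29–30), Proposition 5.3 (p. 30).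
-/

noncomputable section

open MvPolynomial Literature.Barriers.ValiantsHypothesis
open scoped Pointwise
-- `Finset.antidiagonal` alone resolves to the `Set.IsPWO` antidiagonal of `Data.Finset.MulAntidiagonal`
open Finset.HasAntidiagonal (antidiagonal mem_antidiagonal)

namespace Literature.Computability.AlgebraicComplexity

/-! ## Hasse-derivative calculus: product rule, composition, support -/

section HasseCalculus

variable {R : Type*} [CommSemiring R] {σ : Type*}

/-- **Product rule for Hasse derivatives** (AF22 Lemma 2.16, "Using the product rule" in the proof
of Lemma 5.1, p0029:L88): `∂/∂x^a (f·g) = Σ_{b+c=a} ∂/∂x^b(f) · ∂/∂x^c(g)` — the `y^a`-coefficient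
of `f(y+x)·g(y+x)`. [cite: AndrewsForbes2022, Lemma 2.16 and Lemma 5.1 (proof)] -/
theorem mvHasseDeriv_mul [DecidableEq σ] (a : σ →₀ ℕ) (f g : MvPolynomial σ R) :
    mvHasseDeriv a (f * g) =
      ∑ p ∈ antidiagonal a, mvHasseDeriv p.1 f * mvHasseDeriv p.2 g := by
  rw [← Lemma220.coeff_taylor, map_mul, coeff_mul]
  simp_rw [Lemma220.coeff_taylor]

/-- The monomials of `∂/∂x^a (f)` are the monomials of `f` divisible by `x^a`, shifted down by `a`
(Lemma 2.14; this is the multidegree bookkeeping `multideg(∂f/∂x^a) = multideg(f) − a` of the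
proof of Prop. 5.3, p0030:L78). [cite: AndrewsForbes2022, Lemma 2.14 and Prop. 5.3 (proof)] -/
theorem add_mem_support_of_mem_support_mvHasseDeriv {a e : σ →₀ ℕ} {f : MvPolynomial σ R}
    (h : e ∈ (mvHasseDeriv a f).support) : e + a ∈ f.support := by
  rw [mem_support_iff] at h ⊢
  intro h0
  apply h
  rw [coeff_mvHasseDeriv, h0, mul_zero]

/-- A Hasse derivative of positive order kills constants (Lemma 2.14 with `b = 0`).
[cite: AndrewsForbes2022, Lemma 2.14] -/
theorem mvHasseDeriv_C_eq_zero {a : σ →₀ ℕ} (ha : a ≠ 0) (c : R) :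
    mvHasseDeriv a (C c : MvPolynomial σ R) = 0 := by
  rw [← monomial_zero', mvHasseDeriv_monomial, prod_choose_eq_zero_of_not_le, zero_mul, map_zero]
  exact fun h => ha (Finsupp.ext fun i => Nat.le_zero.mp (Finsupp.le_def.mp h i))

/-- The binomial identity behind "partial derivatives commute" for Hasse derivatives:
`binom(E+B, B) · binom(E+B+C, C) = binom(B+C, B) · binom(E+B+C, B+C)`.
[cite: AndrewsForbes2022, Lemma 2.15] -/
theorem choose_mul_choose_eq (E B C : ℕ) :
    (E + B).choose B * (E + B + C).choose C = (B + C).choose B * (E + B + C).choose (B + C) := by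
  have h := Nat.choose_mul (n := E + B + C) (k := B + C) (s := C) (by omega)
  have h1 : E + B + C - C = E + B := by omega
  have h2 : B + C - C = B := by omega
  rw [h1, h2] at h
  have h3 : (B + C).choose C = (B + C).choose B := Nat.choose_symm_add.symm
  rw [mul_comm ((B + C).choose B), ← h3, h, mul_comm]

/-- **Hasse derivatives commute / compose** (AF22 Lemma 2.15, used in the proof of Lemma 5.2,
p0030:L33): `∂/∂x^b (∂/∂x^c f) = (∏ᵢ binom(bᵢ+cᵢ, bᵢ)) · ∂/∂x^{b+c} f`.
[cite: AndrewsForbes2022, Lemma 2.15 and Lemma 5.2 (proof)] -/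
theorem mvHasseDeriv_mvHasseDeriv [DecidableEq σ] (b c : σ →₀ ℕ) (f : MvPolynomial σ R) :
    mvHasseDeriv b (mvHasseDeriv c f) =
      ((∏ i ∈ (b + c).support, ((b + c) i).choose (b i) : ℕ) : R) • mvHasseDeriv (b + c) f := by
  ext e
  rw [coeff_mvHasseDeriv, coeff_mvHasseDeriv, coeff_smul, coeff_mvHasseDeriv, smul_eq_mul,
    ← mul_assoc, ← mul_assoc, add_assoc]
  congr 1
  have hbS : b.support ⊆ (b + c).support := fun i hi => by
    rw [Finsupp.mem_support_iff] at hi ⊢; rw [Finsupp.add_apply]; omega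
  have hcS : c.support ⊆ (b + c).support := fun i hi => by
    rw [Finsupp.mem_support_iff] at hi ⊢; rw [Finsupp.add_apply]; omega
  rw [Finsupp.prod_of_support_subset b hbS _ (fun i _ => by rw [Nat.choose_zero_right, Nat.cast_one]),
    Finsupp.prod_of_support_subset c hcS _ (fun i _ => by rw [Nat.choose_zero_right, Nat.cast_one]),
    Finsupp.prod, ← Finset.prod_mul_distrib, Nat.cast_prod, ← Finset.prod_mul_distrib]
  refine Finset.prod_congr rfl fun i _ => ?_
  rw [← Nat.cast_mul, ← Nat.cast_mul]
  congr 1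
  simp only [Finsupp.add_apply, ← add_assoc]
  exact choose_mul_choose_eq (e i) (b i) (c i)

/-- In characteristic zero a higher mixed Hasse derivative can only be nonzero if the lower one is
("If `ch(F) = 0`, we also obtain `∏ᵢ ∂/∂x_{rᵢ,cᵢ} ((S|T)) ≠ 0`", p0030:L36–L40).
[cite: AndrewsForbes2022, Lemma 5.2 (proof, characteristic-zero clause)] -/
theorem mvHasseDeriv_ne_zero_of_add {F : Type*} [Field F] [CharZero F] [DecidableEq σ]
    (b c : σ →₀ ℕ) (f : MvPolynomial σ F) (h : mvHasseDeriv (b + c) f ≠ 0) :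
    mvHasseDeriv c f ≠ 0 := by
  intro h0
  have h1 := mvHasseDeriv_mvHasseDeriv b c f
  rw [h0] at h1
  have h2 : mvHasseDeriv b (0 : MvPolynomial σ F) = 0 := by
    by_cases hb : b = 0
    · subst hb; exact mvHasseDeriv_zero_left 0
    · have h3 := mvHasseDeriv_C_eq_zero (R := F) (σ := σ) hb 0
      rwa [C_0] at h3
  rw [h2, eq_comm, smul_eq_zero] at h1
  rcases h1 with h1 | h1
  · rw [Nat.cast_eq_zero] at h1
    exact Finset.prod_ne_zero_iff.2 (fun i _ => (Nat.choose_pos (by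
      rw [Finsupp.add_apply]; omega)).ne') h1
  · exact h h1

end HasseCalculus

/-! ## One row: the minor `(S(k,•) | T(k,•))`, its monomials, its Hasse derivatives (Lemma 5.1) -/

section Minor

variable (F : Type*) [Field F] {n m : ℕ}

/-- The positions `S(k,•) × T(k,•)` of the `k`-th row of a bitableau (the set the printed proofs of
Lemmas 5.1/5.2 test membership in: "`(i, j) ∈ S(k,•) × T(k,•)`", p0029:L48).
[cite: AndrewsForbes2022, Lemma 5.1] -/
def rowGrid (ρ : BitableauRow n m) : Finset (Fin n × Fin m) :=
  Finset.univ.image fun p : Fin ρ.1 × Fin ρ.1 => (ρ.2.1 p.1, ρ.2.2 p.2)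

/-- The exponent vector of the monomial `∏ₜ x_{S(k, π t), T(k, t)}` of the minor
`(S(k,•) | T(k,•)) = det X_{S(k,•),T(k,•)}` attached to a permutation `π` (expansion of the
determinant "by minors", proof of Lemma 5.1, p0029:L66). [cite: AndrewsForbes2022, Lemma 5.1 (proof)] -/
def rowMono (ρ : BitableauRow n m) (π : Equiv.Perm (Fin ρ.1)) : Fin n × Fin m →₀ ℕ :=
  ∑ t, Finsupp.single (ρ.2.1 (π t), ρ.2.2 t) 1

/-- The Leibniz expansion of a row minor: `(S(k,•)|T(k,•)) = Σ_π sgn(π) ∏ₜ x_{S(k,π t),T(k,t)}`.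
[cite: AndrewsForbes2022, Def. 2.23 and Lemma 5.1 (proof)] -/
theorem rowMinor_eq_sum (ρ : BitableauRow n m) :
    rowMinor F ρ =
      ∑ π : Equiv.Perm (Fin ρ.1), monomial (rowMono ρ π) (((Equiv.Perm.sign π : ℤ) : F)) := by
  rw [rowMinor, Matrix.det_apply]
  refine Finset.sum_congr rfl fun π _ => ?_
  have h : ∏ t, ((Matrix.mvPolynomialX (Fin n) (Fin m) F).submatrix ρ.2.1 ρ.2.2) (π t) t
      = monomial (rowMono ρ π) 1 := by
    rw [rowMono, monomial_sum_one]
    refine Finset.prod_congr rfl fun t _ => ?_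
    rw [Matrix.submatrix_apply, Matrix.mvPolynomialX_apply]
    rfl
  rw [h, Units.smul_def, ← Int.cast_smul_eq_zsmul F, smul_monomial, smul_eq_mul, mul_one]

/-- The signs `sgn(π) = ±1` are nonzero in a field. [cite: AndrewsForbes2022, Lemma 5.1 (proof)] -/
theorem sign_cast_ne_zero {k : ℕ} (π : Equiv.Perm (Fin k)) :
    (((Equiv.Perm.sign π : ℤ) : F)) ≠ 0 := by
  rcases Int.units_eq_one_or (Equiv.Perm.sign π) with h | h <;> simp [h]

/-- A nonzero row minor has distinct row indices and distinct column indices (a repeated index gives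
two equal rows/columns; implicit in "nonzero bideterminant", Lemma 5.1).
[cite: AndrewsForbes2022, Lemma 5.1] -/
theorem injective_of_rowMinor_ne_zero (ρ : BitableauRow n m) (h : rowMinor F ρ ≠ 0) :
    Function.Injective ρ.2.1 ∧ Function.Injective ρ.2.2 := by
  constructor
  · by_contra hn
    obtain ⟨t, t', htt, hne⟩ := Function.not_injective_iff.1 hn
    exact h (Matrix.det_zero_of_row_eq hne (funext fun j => by
      simp [Matrix.submatrix_apply, htt]))
  · by_contra hn
    obtain ⟨t, t', htt, hne⟩ := Function.not_injective_iff.1 hn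
    exact h (Matrix.det_zero_of_column_eq hne (fun i => by
      simp [Matrix.submatrix_apply, htt]))

/-- In a nonzero bideterminant every row has distinct row indices and distinct column indices.
[cite: AndrewsForbes2022, Lemma 5.1] -/
theorem injective_of_bideterminant_ne_zero (B : Bitableau n m) (h : bideterminant F B ≠ 0) :
    ∀ ρ ∈ B, Function.Injective ρ.2.1 ∧ Function.Injective ρ.2.2 := by
  intro ρ hρ
  refine injective_of_rowMinor_ne_zero F ρ fun h0 => h ?_
  rw [bideterminant]
  exact List.prod_eq_zero (List.mem_map.2 ⟨ρ, hρ, h0⟩)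

variable {F}

/-- With distinct column indices the monomial of `π` is square-free: the indicator of the graph
`{(S(k,π t), T(k,t))}`. [cite: AndrewsForbes2022, Lemma 5.1 (proof)] -/
theorem rowMono_eq_sqfree (ρ : BitableauRow n m) (hc : Function.Injective ρ.2.2)
    (π : Equiv.Perm (Fin ρ.1)) :
    rowMono ρ π = sqfree (Finset.univ.image fun t : Fin ρ.1 => (ρ.2.1 (π t), ρ.2.2 t)) := by
  rw [rowMono, sqfree, Finset.sum_image]
  intro t _ t' _ h
  exact hc (Prod.ext_iff.1 h).2

/-- The graph of `π` lies in `S(k,•) × T(k,•)`. [cite: AndrewsForbes2022, Lemma 5.1 (proof)] -/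
theorem image_subset_rowGrid (ρ : BitableauRow n m) (π : Equiv.Perm (Fin ρ.1)) :
    (Finset.univ.image fun t : Fin ρ.1 => (ρ.2.1 (π t), ρ.2.2 t)) ⊆ rowGrid ρ := by
  intro v hv
  obtain ⟨t, -, rfl⟩ := Finset.mem_image.1 hv
  exact Finset.mem_image.2 ⟨(π t, t), Finset.mem_univ _, rfl⟩

/-- `ideg_{x_{i,j}}` of a minor is `≤ 1`, and `= 0` off `S(k,•) × T(k,•)` (proof of Lemma 5.1,
p0029:L58): every monomial of the minor is below the indicator of `S(k,•) × T(k,•)`.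
[cite: AndrewsForbes2022, Lemma 5.1 (proof)] -/
theorem rowMono_le_sqfree_rowGrid (ρ : BitableauRow n m) (hc : Function.Injective ρ.2.2)
    (π : Equiv.Perm (Fin ρ.1)) : rowMono ρ π ≤ sqfree (rowGrid ρ) := by
  rw [rowMono_eq_sqfree ρ hc, sqfree_le_sqfree_iff]
  exact image_subset_rowGrid ρ π

/-- Distinct permutations give distinct monomials of the minor (distinct row and column indices).
[cite: AndrewsForbes2022, Lemma 5.1 (proof)] -/
theorem rowMono_injective (ρ : BitableauRow n m) (hr : Function.Injective ρ.2.1)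
    (hc : Function.Injective ρ.2.2) : Function.Injective (rowMono ρ) := by
  intro π π' h
  rw [rowMono_eq_sqfree ρ hc, rowMono_eq_sqfree ρ hc] at h
  have hset := sqfree_injective h
  ext t
  have ht : (ρ.2.1 (π t), ρ.2.2 t) ∈
      Finset.univ.image fun t : Fin ρ.1 => (ρ.2.1 (π' t), ρ.2.2 t) := by
    rw [← hset]
    exact Finset.mem_image.2 ⟨t, Finset.mem_univ _, rfl⟩
  obtain ⟨t', -, ht'⟩ := Finset.mem_image.1 ht
  obtain ⟨h1, h2⟩ := Prod.ext_iff.1 ht'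
  have htt : t' = t := hc h2
  subst htt
  exact congrArg Fin.val (hr h1).symm

/-- The coefficient of the minor at the monomial of `π` is `sgn(π)`.
[cite: AndrewsForbes2022, Lemma 5.1 (proof)] -/
theorem coeff_rowMono_rowMinor (ρ : BitableauRow n m) (hr : Function.Injective ρ.2.1)
    (hc : Function.Injective ρ.2.2) (π : Equiv.Perm (Fin ρ.1)) :
    coeff (rowMono ρ π) (rowMinor F ρ) = ((Equiv.Perm.sign π : ℤ) : F) := by
  classical
  rw [rowMinor_eq_sum, coeff_sum]
  simp_rw [coeff_monomial]
  rw [Finset.sum_eq_single π]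
  · rw [if_pos rfl]
  · intro π' _ hne
    rw [if_neg fun h => hne (rowMono_injective ρ hr hc h)]
  · exact fun h => (h (Finset.mem_univ _)).elim

/-- **Lemma 5.1, vanishing part**: a Hasse derivative `∂/∂x^b` of a row minor is zero unless `x^b`
divides one of its (square-free) monomials — in particular unless `b ≤ 𝟙_{S(k,•) × T(k,•)}`
("for `ℓ > ideg_{x_{i,j}}` … the derivative is `0`", p0029:L72).
[cite: AndrewsForbes2022, Lemma 5.1 (proof)] -/
theorem exists_le_rowMono_of_mvHasseDeriv_ne_zero (ρ : BitableauRow n m) {b : Fin n × Fin m →₀ ℕ}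
    (h : mvHasseDeriv b (rowMinor F ρ) ≠ 0) : ∃ π, b ≤ rowMono ρ π := by
  by_contra hle
  push Not at hle
  apply h
  rw [rowMinor_eq_sum, mvHasseDeriv_sum]
  refine Finset.sum_eq_zero fun π _ => ?_
  rw [mvHasseDeriv_monomial, prod_choose_eq_zero_of_not_le (hle π), zero_mul, map_zero]

/-- **Lemma 5.1, vanishing part** in the form used below: `∂/∂x^b (S(k,•)|T(k,•)) ≠ 0` forces
`b ≤ 𝟙_{S(k,•) × T(k,•)}`. [cite: AndrewsForbes2022, Lemma 5.1 (proof)] -/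
theorem le_sqfree_rowGrid_of_mvHasseDeriv_ne_zero (ρ : BitableauRow n m)
    (hc : Function.Injective ρ.2.2) {b : Fin n × Fin m →₀ ℕ}
    (h : mvHasseDeriv b (rowMinor F ρ) ≠ 0) : b ≤ sqfree (rowGrid ρ) := by
  obtain ⟨π, hπ⟩ := exists_le_rowMono_of_mvHasseDeriv_ne_zero ρ h
  exact hπ.trans (rowMono_le_sqfree_rowGrid ρ hc π)

/-- Two injections into a finite type differ by a permutation (extension of the partial matching
`cᵢ ↦ rᵢ` to a permutation, as in the choice of a nonzero term in the proof of Lemma 5.1). [folklore] -/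
private theorem exists_perm_forall_apply_eq {α β : Type*} [Fintype β] [DecidableEq β] (f g : α → β)
    (hf : Function.Injective f) (hg : Function.Injective g) :
    ∃ π : Equiv.Perm β, ∀ a, π (f a) = g a := by
  classical
  let e : {b // b ∈ Set.range f} ≃ {b // b ∈ Set.range g} :=
    (Equiv.ofInjective f hf).symm.trans (Equiv.ofInjective g hg)
  refine ⟨e.extendSubtype, fun a => ?_⟩
  rw [Equiv.extendSubtype_apply_of_mem e (f a) ⟨a, rfl⟩]
  simp only [e, Equiv.trans_apply]
  have : (Equiv.ofInjective f hf).symm ⟨f a, ⟨a, rfl⟩⟩ = a :=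
    (Equiv.ofInjective f hf).symm_apply_eq.2 rfl
  rw [this, Equiv.ofInjective_apply]

/-- **Lemma 5.1 / 5.2, non-vanishing part for one row**: for a set `Q ⊆ S(k,•) × T(k,•)` of
positions with distinct rows and distinct columns, the mixed first-order Hasse derivative
`∂/∂x^{𝟙_Q} (S(k,•)|T(k,•))` is nonzero (it is `±` the complementary minor `(S'(k,•)|T'(k,•))`,
p0029:L44–L52: here we exhibit its monomial coming from a permutation extending `Q`, with
coefficient `±1`). [cite: AndrewsForbes2022, Lemma 5.1 and Lemma 5.2] -/
theorem mvHasseDeriv_sqfree_rowMinor_ne_zero (ρ : BitableauRow n m) (hr : Function.Injective ρ.2.1)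
    (hc : Function.Injective ρ.2.2) (Q : Finset (Fin n × Fin m))
    (hQ1 : Set.InjOn Prod.fst (Q : Set (Fin n × Fin m)))
    (hQ2 : Set.InjOn Prod.snd (Q : Set (Fin n × Fin m))) (hQ : Q ⊆ rowGrid ρ) :
    mvHasseDeriv (sqfree Q) (rowMinor F ρ) ≠ 0 := by
  classical
  -- pull the positions back to `[s] × [s]`
  have hpre : ∀ q : Q, ∃ p : Fin ρ.1 × Fin ρ.1, (ρ.2.1 p.1, ρ.2.2 p.2) = (q : Fin n × Fin m) := by
    intro q
    obtain ⟨p, -, hp⟩ := Finset.mem_image.1 (hQ q.2)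
    exact ⟨p, hp⟩
  choose pre hpre using hpre
  have hcol : Function.Injective fun q : Q => (pre q).2 := by
    intro q q' h
    apply Subtype.ext
    apply hQ2 q.2 q'.2
    have h1 : ρ.2.2 (pre q).2 = (q : Fin n × Fin m).2 := congrArg Prod.snd (hpre q)
    have h2 : ρ.2.2 (pre q').2 = (q' : Fin n × Fin m).2 := congrArg Prod.snd (hpre q')
    rw [← h1, ← h2]
    exact congrArg ρ.2.2 h
  have hrow : Function.Injective fun q : Q => (pre q).1 := by
    intro q q' h
    apply Subtype.ext
    apply hQ1 q.2 q'.2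
    have h1 : ρ.2.1 (pre q).1 = (q : Fin n × Fin m).1 := congrArg Prod.fst (hpre q)
    have h2 : ρ.2.1 (pre q').1 = (q' : Fin n × Fin m).1 := congrArg Prod.fst (hpre q')
    rw [← h1, ← h2]
    exact congrArg ρ.2.1 h
  obtain ⟨π, hπ⟩ := exists_perm_forall_apply_eq _ _ hcol hrow
  -- the monomial of `π` is divisible by `x^{𝟙_Q}`
  have hle : sqfree Q ≤ rowMono ρ π := by
    rw [rowMono_eq_sqfree ρ hc, sqfree_le_sqfree_iff]
    intro v hv
    refine Finset.mem_image.2 ⟨(pre ⟨v, hv⟩).2, Finset.mem_univ _, ?_⟩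
    have h1 : π (pre ⟨v, hv⟩).2 = (pre ⟨v, hv⟩).1 := hπ ⟨v, hv⟩
    rw [h1]
    exact hpre ⟨v, hv⟩
  -- its coefficient in the derivative is `sgn(π) ≠ 0`
  have hone : ((sqfree Q).prod fun i k => (((rowMono ρ π - sqfree Q + sqfree Q) i).choose k : F)) = 1 := by
    rw [tsub_add_cancel_of_le hle, Finsupp.prod]
    refine Finset.prod_eq_one fun i hi => ?_
    have h1 : sqfree Q i = 1 := by
      rw [sqfree_apply, if_pos]
      by_contra hiQ
      rw [Finsupp.mem_support_iff, sqfree_apply, if_neg hiQ] at hi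
      exact hi rfl
    have h2 : rowMono ρ π i = 1 := by
      refine le_antisymm ?_ (h1 ▸ Finsupp.le_def.1 hle i)
      have := Finsupp.le_def.1 (rowMono_le_sqfree_rowGrid ρ hc π) i
      rw [sqfree_apply] at this
      split_ifs at this <;> omega
    rw [h1, h2, Nat.choose_self, Nat.cast_one]
  intro h0
  have hcoeff := coeff_mvHasseDeriv (sqfree Q) (rowMono ρ π - sqfree Q) (rowMinor F ρ)
  rw [h0, coeff_zero, hone, one_mul, tsub_add_cancel_of_le hle, coeff_rowMono_rowMinor ρ hr hc] at hcoeff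
  exact sign_cast_ne_zero (F := F) π hcoeff.symm

end Minor

/-! ## All rows: the exponent of `∂/∂x_{R,C}` and the product formula (Lemmas 5.1 + 5.2) -/

section Rows

variable (F : Type*) [Field F] {n m : ℕ}

/-- The exponent vector of the printed operator `∂/∂x_{R,C} = ∏ᵢ ∂^{dᵢ}/∂x_{rᵢ,cᵢ}^{dᵢ}` for the
set of positions `P = {(rᵢ, cᵢ)}`: `dᵢ = #{k : (rᵢ, cᵢ) ∈ S(k,•) × T(k,•)} = ideg_{x_{rᵢ,cᵢ}}(S|T)`
(proof of Lemma 5.1, p0029:L54–L60, iterated in Lemma 5.2), i.e. `Σₖ 𝟙_{P ∩ (S(k,•) × T(k,•))}`.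
[cite: AndrewsForbes2022, Lemma 5.2 and Prop. 5.3 (proof)] -/
def hasseIdx (B : Bitableau n m) (P : Finset (Fin n × Fin m)) : Fin n × Fin m →₀ ℕ :=
  (B.map fun ρ => sqfree (P ∩ rowGrid ρ)).sum

/-- The vector of all individual-degree caps `Σₖ 𝟙_{S(k,•) × T(k,•)}` (`ideg_{x_{i,j}}(S|T) ≤`
the number of rows whose grid contains `(i,j)`, proof of Lemma 5.1).
[cite: AndrewsForbes2022, Lemma 5.1 (proof)] -/
def cap (B : Bitableau n m) : Fin n × Fin m →₀ ℕ :=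
  (B.map fun ρ => sqfree (rowGrid ρ)).sum

/-- Unfolding `hasseIdx` on a cons. [cite: AndrewsForbes2022, Lemma 5.2] -/
@[simp] theorem hasseIdx_cons (ρ : BitableauRow n m) (B : Bitableau n m)
    (P : Finset (Fin n × Fin m)) :
    hasseIdx (ρ :: B) P = sqfree (P ∩ rowGrid ρ) + hasseIdx B P := by
  simp [hasseIdx]

/-- Unfolding `hasseIdx` on the empty bitableau. [cite: AndrewsForbes2022, Lemma 5.2] -/
@[simp] theorem hasseIdx_nil (P : Finset (Fin n × Fin m)) :
    hasseIdx ([] : Bitableau n m) P = 0 := by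
  simp [hasseIdx]

/-- Unfolding `cap` on a cons. [cite: AndrewsForbes2022, Lemma 5.1] -/
@[simp] theorem cap_cons (ρ : BitableauRow n m) (B : Bitableau n m) :
    cap (ρ :: B) = sqfree (rowGrid ρ) + cap B := by
  simp [cap]

/-- Unfolding `cap` on the empty bitableau. [cite: AndrewsForbes2022, Lemma 5.1] -/
@[simp] theorem cap_nil : cap ([] : Bitableau n m) = 0 := by
  simp [cap]

/-- On a position of `P` the exponent `dᵢ` is the full count of rows containing it.
[cite: AndrewsForbes2022, Lemma 5.1 (proof)] -/
theorem hasseIdx_apply_of_mem (B : Bitableau n m) {P : Finset (Fin n × Fin m)}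
    {v : Fin n × Fin m} (hv : v ∈ P) : hasseIdx B P v = cap B v := by
  induction B with
  | nil => simp
  | cons ρ B ih =>
    simp only [hasseIdx_cons, cap_cons, Finsupp.add_apply, ih, sqfree_apply, Finset.mem_inter, hv,
      true_and]

/-- Off `P` the exponent vector vanishes. [cite: AndrewsForbes2022, Lemma 5.2] -/
theorem hasseIdx_apply_of_not_mem (B : Bitableau n m) {P : Finset (Fin n × Fin m)}
    {v : Fin n × Fin m} (hv : v ∉ P) : hasseIdx B P v = 0 := by
  induction B with
  | nil => simp
  | cons ρ B ih =>
    simp only [hasseIdx_cons, Finsupp.add_apply, ih, sqfree_apply, Finset.mem_inter, hv,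
      false_and, if_false]

/-- **`ideg` bound for a bideterminant** (proof of Lemma 5.1: `ideg_{x_{i,j}}` of a product of minors
is the number of factors containing `x_{i,j}`): `∂/∂x^c (S|T) ≠ 0` forces `c ≤ Σₖ 𝟙_{S(k,•)×T(k,•)}`.
[cite: AndrewsForbes2022, Lemma 5.1 (proof)] -/
theorem le_cap_of_mvHasseDeriv_bideterminant_ne_zero (B : Bitableau n m)
    (hB : ∀ ρ ∈ B, Function.Injective ρ.2.2) {c : Fin n × Fin m →₀ ℕ}
    (h : mvHasseDeriv c (bideterminant F B) ≠ 0) : c ≤ cap B := by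
  classical
  induction B generalizing c with
  | nil =>
    rw [cap_nil]
    by_contra hc
    have hc0 : c ≠ 0 := fun h0 => hc (h0 ▸ le_rfl)
    apply h
    rw [bideterminant_nil, ← C_1]
    exact mvHasseDeriv_C_eq_zero hc0 1
  | cons ρ B ih =>
    rw [bideterminant_cons, mvHasseDeriv_mul] at h
    obtain ⟨p, hp, hne⟩ := Finset.exists_ne_zero_of_sum_ne_zero h
    rw [mem_antidiagonal] at hp
    rw [cap_cons, ← hp]
    exact add_le_add
      (le_sqfree_rowGrid_of_mvHasseDeriv_ne_zero ρ (hB ρ (by simp)) (left_ne_zero_of_mul hne))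
      (ih (fun ρ' hρ' => hB ρ' (by simp [hρ'])) (right_ne_zero_of_mul hne))

/-- **Lemmas 5.1 + 5.2 in closed form**: the mixed top Hasse derivative `∂/∂x_{R,C}` of a
bideterminant is the product over the rows of the first-order mixed derivatives of the row minors
along the positions of `P` inside that row ("`= ∏ₖ (±(S'(k,•)|T'(k,•))) = ± (S'|T')`", p0029:L92):
in the product rule every other term vanishes. [cite: AndrewsForbes2022, Lemma 5.1 and Lemma 5.2] -/
theorem mvHasseDeriv_hasseIdx_bideterminant (B : Bitableau n m)
    (hB : ∀ ρ ∈ B, Function.Injective ρ.2.2) (P : Finset (Fin n × Fin m)) :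
    mvHasseDeriv (hasseIdx B P) (bideterminant F B) =
      (B.map fun ρ => mvHasseDeriv (sqfree (P ∩ rowGrid ρ)) (rowMinor F ρ)).prod := by
  classical
  induction B with
  | nil => simp [bideterminant_nil]
  | cons ρ B ih =>
    have hBt : ∀ ρ' ∈ B, Function.Injective ρ'.2.2 := fun ρ' hρ' => hB ρ' (by simp [hρ'])
    rw [bideterminant_cons, mvHasseDeriv_mul, hasseIdx_cons, List.map_cons, List.prod_cons, ← ih hBt,
      Finset.sum_eq_single (sqfree (P ∩ rowGrid ρ), hasseIdx B P)]
    · rintro ⟨b, b'⟩ hp hne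
      rw [mem_antidiagonal] at hp
      dsimp only at hp hne ⊢
      by_contra h0
      have h1 := le_sqfree_rowGrid_of_mvHasseDeriv_ne_zero ρ (hB ρ (by simp)) (left_ne_zero_of_mul h0)
      have h2 := le_cap_of_mvHasseDeriv_bideterminant_ne_zero F B hBt (right_ne_zero_of_mul h0)
      apply hne
      have hb : b = sqfree (P ∩ rowGrid ρ) := by
        ext v
        have hv := congrArg (fun f => f v) hp
        simp only [Finsupp.add_apply] at hv
        have h1v := Finsupp.le_def.1 h1 v
        have h2v := Finsupp.le_def.1 h2 v
        by_cases hvP : v ∈ P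
        · rw [hasseIdx_apply_of_mem B hvP] at hv
          rw [sqfree_apply] at h1v hv ⊢
          simp only [Finset.mem_inter, hvP, true_and] at hv ⊢
          split_ifs at h1v hv ⊢ <;> omega
        · rw [hasseIdx_apply_of_not_mem B hvP, sqfree_apply, if_neg (fun h => hvP
            (Finset.mem_inter.1 h).1)] at hv
          rw [sqfree_apply, if_neg (fun h => hvP (Finset.mem_inter.1 h).1)]
          omega
      subst hb
      exact Prod.ext rfl (add_left_cancel hp)
    · intro h
      exact (h (mem_antidiagonal.2 rfl)).elim

/-- **Lemma 5.2 (non-vanishing)**: for positions `P` with distinct rows and distinct columns,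
`∂/∂x_{R,C} (S|T) = (∏ᵢ ∂^{dᵢ}/∂x_{rᵢ,cᵢ}^{dᵢ}) (S|T) ≠ 0` for a nonzero bideterminant.
[cite: AndrewsForbes2022, Lemma 5.2] -/
theorem mvHasseDeriv_hasseIdx_bideterminant_ne_zero (B : Bitableau n m)
    (hB : ∀ ρ ∈ B, Function.Injective ρ.2.1 ∧ Function.Injective ρ.2.2)
    (P : Finset (Fin n × Fin m)) (hP1 : Set.InjOn Prod.fst (P : Set (Fin n × Fin m)))
    (hP2 : Set.InjOn Prod.snd (P : Set (Fin n × Fin m))) :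
    mvHasseDeriv (hasseIdx B P) (bideterminant F B) ≠ 0 := by
  classical
  rw [mvHasseDeriv_hasseIdx_bideterminant F B (fun ρ hρ => (hB ρ hρ).2) P]
  apply List.prod_ne_zero
  rw [List.mem_map]
  rintro ⟨ρ, hρ, h0⟩
  exact mvHasseDeriv_sqfree_rowMinor_ne_zero ρ (hB ρ hρ).1 (hB ρ hρ).2 (P ∩ rowGrid ρ)
    (hP1.mono (Finset.coe_subset.2 Finset.inter_subset_left))
    (hP2.mono (Finset.coe_subset.2 Finset.inter_subset_left)) Finset.inter_subset_right h0

/-- **Lemma 5.2, characteristic zero** ("we may take `d₁ = ⋯ = d_ℓ = 1`"): the plain mixed partial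
`∏ᵢ ∂/∂x_{rᵢ,cᵢ} (S|T)` is nonzero, provided every position of `P` occurs in some row.
[cite: AndrewsForbes2022, Lemma 5.2 (characteristic-zero clause)] -/
theorem mvHasseDeriv_sqfree_bideterminant_ne_zero [CharZero F] (B : Bitableau n m)
    (hB : ∀ ρ ∈ B, Function.Injective ρ.2.1 ∧ Function.Injective ρ.2.2)
    (P : Finset (Fin n × Fin m)) (hP1 : Set.InjOn Prod.fst (P : Set (Fin n × Fin m)))
    (hP2 : Set.InjOn Prod.snd (P : Set (Fin n × Fin m))) (hle : sqfree P ≤ hasseIdx B P) :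
    mvHasseDeriv (sqfree P) (bideterminant F B) ≠ 0 := by
  classical
  refine mvHasseDeriv_ne_zero_of_add (hasseIdx B P - sqfree P) (sqfree P) _ ?_
  rw [tsub_add_cancel_of_le hle]
  exact mvHasseDeriv_hasseIdx_bideterminant_ne_zero F B hB P hP1 hP2

end Rows

/-! ## Multidegree (proof of Prop. 5.3: "nonzero, multihomogeneous, and of distinct multidegree") -/

section Multidegree

variable (F : Type*) [Field F] {n m : ℕ}

/-- The row part of the multidegree `multideg` of a monomial in the matrix variables: row `i` gets
`Σⱼ e(i,j)` (§2 "multideg", used in the proof of Prop. 5.3, p0030:L78–L100).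
[cite: AndrewsForbes2022, Prop. 5.3 (proof)] -/
def rowDeg : (Fin n × Fin m →₀ ℕ) →+ (Fin n →₀ ℕ) := Finsupp.mapDomain.addMonoidHom Prod.fst

/-- The column part of the multidegree `multideg`. [cite: AndrewsForbes2022, Prop. 5.3 (proof)] -/
def colDeg : (Fin n × Fin m →₀ ℕ) →+ (Fin m →₀ ℕ) := Finsupp.mapDomain.addMonoidHom Prod.snd

/-- `rowDeg` of a single position. [cite: AndrewsForbes2022, Prop. 5.3 (proof)] -/
@[simp] theorem rowDeg_single (p : Fin n × Fin m) (k : ℕ) :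
    rowDeg (Finsupp.single p k) = Finsupp.single p.1 k := by
  simp [rowDeg, Finsupp.mapDomain_single]

/-- `colDeg` of a single position. [cite: AndrewsForbes2022, Prop. 5.3 (proof)] -/
@[simp] theorem colDeg_single (p : Fin n × Fin m) (k : ℕ) :
    colDeg (Finsupp.single p k) = Finsupp.single p.2 k := by
  simp [colDeg, Finsupp.mapDomain_single]

/-- The row multidegree `Σₜ e_{S(k,t)}` common to all monomials of the `k`-th row minor.
[cite: AndrewsForbes2022, Prop. 5.3 (proof)] -/
def rowVec (ρ : BitableauRow n m) : Fin n →₀ ℕ := ∑ t, Finsupp.single (ρ.2.1 t) 1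

/-- The column multidegree `Σₜ e_{T(k,t)}` common to all monomials of the `k`-th row minor.
[cite: AndrewsForbes2022, Prop. 5.3 (proof)] -/
def colVec (ρ : BitableauRow n m) : Fin m →₀ ℕ := ∑ t, Finsupp.single (ρ.2.2 t) 1

/-- Every monomial of a row minor has row multidegree `rowVec`. [cite: AndrewsForbes2022, Prop. 5.3 (proof)] -/
theorem rowDeg_rowMono (ρ : BitableauRow n m) (π : Equiv.Perm (Fin ρ.1)) :
    rowDeg (rowMono ρ π) = rowVec ρ := by
  rw [rowMono, map_sum, rowVec]
  simp_rw [rowDeg_single]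
  exact Equiv.sum_comp π (fun t => Finsupp.single (ρ.2.1 t) 1)

/-- Every monomial of a row minor has column multidegree `colVec`. [cite: AndrewsForbes2022, Prop. 5.3 (proof)] -/
theorem colDeg_rowMono (ρ : BitableauRow n m) (π : Equiv.Perm (Fin ρ.1)) :
    colDeg (rowMono ρ π) = colVec ρ := by
  rw [rowMono, map_sum, colVec]
  simp_rw [colDeg_single]

/-- Row minors are multihomogeneous. [cite: AndrewsForbes2022, Prop. 5.3 (proof)] -/
theorem multideg_of_mem_support_rowMinor (ρ : BitableauRow n m) {μ : Fin n × Fin m →₀ ℕ}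
    (h : μ ∈ (rowMinor F ρ).support) : rowDeg μ = rowVec ρ ∧ colDeg μ = colVec ρ := by
  classical
  rw [rowMinor_eq_sum] at h
  obtain ⟨π, -, hπ⟩ := Finset.mem_biUnion.1 (support_sum h)
  have hμ : μ = rowMono ρ π := Finset.mem_singleton.1 (support_monomial_subset hπ)
  subst hμ
  exact ⟨rowDeg_rowMono ρ π, colDeg_rowMono ρ π⟩

/-- **Bideterminants are multihomogeneous** ("the elements of `D` are nonzero, multihomogeneous",
p0030:L100): every monomial of `(S|T)` has multidegree `(Σₖ rowVec, Σₖ colVec)`.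
[cite: AndrewsForbes2022, Prop. 5.3 (proof)] -/
theorem multideg_of_mem_support_bideterminant (B : Bitableau n m) {μ : Fin n × Fin m →₀ ℕ}
    (h : μ ∈ (bideterminant F B).support) :
    rowDeg μ = (B.map rowVec).sum ∧ colDeg μ = (B.map colVec).sum := by
  classical
  induction B generalizing μ with
  | nil =>
    rw [bideterminant_nil, ← C_1, ← monomial_zero'] at h
    have hμ : μ = 0 := Finset.mem_singleton.1 (support_monomial_subset h)
    subst hμ
    simp
  | cons ρ B ih =>
    rw [bideterminant_cons] at h
    obtain ⟨μ₁, hμ₁, μ₂, hμ₂, rfl⟩ := Finset.mem_add.1 (support_mul _ _ h)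
    obtain ⟨h1, h2⟩ := multideg_of_mem_support_rowMinor F ρ hμ₁
    obtain ⟨h3, h4⟩ := ih hμ₂
    simp [map_add, h1, h2, h3, h4]

variable {F}

/-- Row `i` occurs in the multidegree of `x^{𝟙_Q}` iff `Q` has a position in row `i`.
[cite: AndrewsForbes2022, Prop. 5.3 (proof)] -/
theorem rowDeg_sqfree_apply_ne_zero_iff (Q : Finset (Fin n × Fin m)) (i : Fin n) :
    rowDeg (sqfree Q) i ≠ 0 ↔ ∃ q ∈ Q, q.1 = i := by
  classical
  rw [sqfree, map_sum, Finsupp.finsetSum_apply, Ne, Finset.sum_eq_zero_iff]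
  push Not
  refine exists_congr fun q => and_congr_right fun _ => ?_
  rw [rowDeg_single, Finsupp.single_apply_ne_zero]
  simp [eq_comm]

/-- Column `j` occurs in the multidegree of `x^{𝟙_Q}` iff `Q` has a position in column `j`.
[cite: AndrewsForbes2022, Prop. 5.3 (proof)] -/
theorem colDeg_sqfree_apply_ne_zero_iff (Q : Finset (Fin n × Fin m)) (j : Fin m) :
    colDeg (sqfree Q) j ≠ 0 ↔ ∃ q ∈ Q, q.2 = j := by
  classical
  rw [sqfree, map_sum, Finsupp.finsetSum_apply, Ne, Finset.sum_eq_zero_iff]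
  push Not
  refine exists_congr fun q => and_congr_right fun _ => ?_
  rw [colDeg_single, Finsupp.single_apply_ne_zero]
  simp [eq_comm]

/-- Row `i` occurs in the multidegree of the exponent `Σₖ 𝟙_{P ∩ (S(k,•)×T(k,•))}` iff some row of
the bitableau contains a position of `P` in row `i`. [cite: AndrewsForbes2022, Prop. 5.3 (proof)] -/
theorem rowDeg_hasseIdx_apply_ne_zero_iff (B : Bitableau n m) (P : Finset (Fin n × Fin m))
    (i : Fin n) :
    rowDeg (hasseIdx B P) i ≠ 0 ↔ ∃ ρ ∈ B, ∃ q ∈ P ∩ rowGrid ρ, q.1 = i := by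
  induction B with
  | nil => simp
  | cons ρ B ih =>
    rw [hasseIdx_cons, map_add, Finsupp.add_apply]
    constructor
    · intro h
      by_cases h1 : rowDeg (sqfree (P ∩ rowGrid ρ)) i = 0
      · rw [h1, zero_add] at h
        obtain ⟨ρ', hρ', q, hq, hqi⟩ := ih.1 h
        exact ⟨ρ', List.mem_cons.2 (Or.inr hρ'), q, hq, hqi⟩
      · obtain ⟨q, hq, hqi⟩ := (rowDeg_sqfree_apply_ne_zero_iff _ i).1 h1
        exact ⟨ρ, List.mem_cons.2 (Or.inl rfl), q, hq, hqi⟩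
    · rintro ⟨ρ', hρ', q, hq, hqi⟩
      rcases List.mem_cons.1 hρ' with rfl | hρ'
      · have := (rowDeg_sqfree_apply_ne_zero_iff _ i).2 ⟨q, hq, hqi⟩
        omega
      · have := ih.2 ⟨ρ', hρ', q, hq, hqi⟩
        omega

/-- Column analogue of `rowDeg_hasseIdx_apply_ne_zero_iff`. [cite: AndrewsForbes2022, Prop. 5.3 (proof)] -/
theorem colDeg_hasseIdx_apply_ne_zero_iff (B : Bitableau n m) (P : Finset (Fin n × Fin m))
    (j : Fin m) :
    colDeg (hasseIdx B P) j ≠ 0 ↔ ∃ ρ ∈ B, ∃ q ∈ P ∩ rowGrid ρ, q.2 = j := by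
  induction B with
  | nil => simp
  | cons ρ B ih =>
    rw [hasseIdx_cons, map_add, Finsupp.add_apply]
    constructor
    · intro h
      by_cases h1 : colDeg (sqfree (P ∩ rowGrid ρ)) j = 0
      · rw [h1, zero_add] at h
        obtain ⟨ρ', hρ', q, hq, hqi⟩ := ih.1 h
        exact ⟨ρ', List.mem_cons.2 (Or.inr hρ'), q, hq, hqi⟩
      · obtain ⟨q, hq, hqi⟩ := (colDeg_sqfree_apply_ne_zero_iff _ j).1 h1
        exact ⟨ρ, List.mem_cons.2 (Or.inl rfl), q, hq, hqi⟩
    · rintro ⟨ρ', hρ', q, hq, hqi⟩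
      rcases List.mem_cons.1 hρ' with rfl | hρ'
      · have := (colDeg_sqfree_apply_ne_zero_iff _ j).2 ⟨q, hq, hqi⟩
        omega
      · have := ih.2 ⟨ρ', hρ', q, hq, hqi⟩
        omega

end Multidegree

/-! ## The family `D` of Prop. 5.3: one derivative per pair `(R, C)` of equinumerous subsets -/

section Family

variable (F : Type*) [Field F] {n m : ℕ} (ρ₀ : BitableauRow n m)

/-- The positions `{(r₁,c₁), …, (r_ℓ,c_ℓ)}` attached to a pair `(R, C)`, `|R| = |C| = ℓ`, of subsets
of the positions of the chosen row `(S(1,•), T(1,•))` ("Write `R = {r₁,…,r_ℓ}` and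
`C = {c₁,…,c_ℓ}`", p0029:L108; we match them in increasing order). The pair is indexed by subsets
of `[r]`, `r` the length of the row, through the tree's `PairIdx`.
[cite: AndrewsForbes2022, Lemma 5.2 and Prop. 5.3 (proof)] -/
def pairMatching {k : ℕ} (AB : PairIdx ρ₀.1 k) : Finset (Fin n × Fin m) :=
  Finset.univ.image fun t : Fin k =>
    (ρ₀.2.1 (AB.1.1.orderEmbOfFin AB.1.2 t), ρ₀.2.2 (AB.2.1.orderEmbOfFin AB.2.2 t))

variable {ρ₀}

/-- The positions of `(R, C)` lie in the grid of the chosen row. [cite: AndrewsForbes2022, Prop. 5.3 (proof)] -/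
theorem pairMatching_subset_rowGrid {k : ℕ} (AB : PairIdx ρ₀.1 k) :
    pairMatching ρ₀ AB ⊆ rowGrid ρ₀ := by
  intro q hq
  obtain ⟨t, -, rfl⟩ := Finset.mem_image.1 hq
  exact Finset.mem_image.2 ⟨(_, _), Finset.mem_univ _, rfl⟩

/-- The positions of `(R, C)` have distinct rows. [cite: AndrewsForbes2022, Lemma 5.2] -/
theorem injOn_fst_pairMatching (hr₀ : Function.Injective ρ₀.2.1) {k : ℕ} (AB : PairIdx ρ₀.1 k) :
    Set.InjOn Prod.fst (pairMatching ρ₀ AB : Set (Fin n × Fin m)) := by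
  intro q hq q' hq' h
  obtain ⟨t, -, rfl⟩ := Finset.mem_image.1 (Finset.mem_coe.1 hq)
  obtain ⟨t', -, rfl⟩ := Finset.mem_image.1 (Finset.mem_coe.1 hq')
  have ht : t = t' := (AB.1.1.orderEmbOfFin AB.1.2).injective (hr₀ h)
  rw [ht]

/-- The positions of `(R, C)` have distinct columns. [cite: AndrewsForbes2022, Lemma 5.2] -/
theorem injOn_snd_pairMatching (hc₀ : Function.Injective ρ₀.2.2) {k : ℕ} (AB : PairIdx ρ₀.1 k) :
    Set.InjOn Prod.snd (pairMatching ρ₀ AB : Set (Fin n × Fin m)) := by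
  intro q hq q' hq' h
  obtain ⟨t, -, rfl⟩ := Finset.mem_image.1 (Finset.mem_coe.1 hq)
  obtain ⟨t', -, rfl⟩ := Finset.mem_image.1 (Finset.mem_coe.1 hq')
  have ht : t = t' := (AB.2.1.orderEmbOfFin AB.2.2).injective (hc₀ h)
  rw [ht]

/-- `|{(r₁,c₁), …, (r_ℓ,c_ℓ)}| = ℓ`. [cite: AndrewsForbes2022, Lemma 5.2] -/
theorem card_pairMatching (hr₀ : Function.Injective ρ₀.2.1) {k : ℕ} (AB : PairIdx ρ₀.1 k) :
    (pairMatching ρ₀ AB).card = k := by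
  rw [pairMatching, Finset.card_image_of_injective, Finset.card_univ, Fintype.card_fin]
  intro t t' h
  exact (AB.1.1.orderEmbOfFin AB.1.2).injective (hr₀ (Prod.ext_iff.1 h).1)

/-- The rows of the positions of `(R, C)` are exactly (the row indices at) `R`.
[cite: AndrewsForbes2022, Prop. 5.3 (proof)] -/
theorem exists_fst_eq_iff (hr₀ : Function.Injective ρ₀.2.1) {k : ℕ} (AB : PairIdx ρ₀.1 k)
    (u : Fin ρ₀.1) : (∃ q ∈ pairMatching ρ₀ AB, q.1 = ρ₀.2.1 u) ↔ u ∈ AB.1.1 := by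
  constructor
  · rintro ⟨q, hq, hq1⟩
    obtain ⟨t, -, rfl⟩ := Finset.mem_image.1 hq
    rw [← hr₀ hq1]
    exact Finset.orderEmbOfFin_mem _ _ t
  · intro hu
    have hu' : u ∈ Set.range (AB.1.1.orderEmbOfFin AB.1.2) := by
      rw [Finset.range_orderEmbOfFin]; exact hu
    obtain ⟨t, ht⟩ := hu'
    exact ⟨_, Finset.mem_image.2 ⟨t, Finset.mem_univ _, rfl⟩, by simp [ht]⟩

/-- The columns of the positions of `(R, C)` are exactly (the column indices at) `C`.
[cite: AndrewsForbes2022, Prop. 5.3 (proof)] -/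
theorem exists_snd_eq_iff (hc₀ : Function.Injective ρ₀.2.2) {k : ℕ} (AB : PairIdx ρ₀.1 k)
    (v : Fin ρ₀.1) : (∃ q ∈ pairMatching ρ₀ AB, q.2 = ρ₀.2.2 v) ↔ v ∈ AB.2.1 := by
  constructor
  · rintro ⟨q, hq, hq1⟩
    obtain ⟨t, -, rfl⟩ := Finset.mem_image.1 hq
    rw [← hc₀ hq1]
    exact Finset.orderEmbOfFin_mem _ _ t
  · intro hv
    have hv' : v ∈ Set.range (AB.2.1.orderEmbOfFin AB.2.2) := by
      rw [Finset.range_orderEmbOfFin]; exact hv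
    obtain ⟨t, ht⟩ := hv'
    exact ⟨_, Finset.mem_image.2 ⟨t, Finset.mem_univ _, rfl⟩, by simp [ht]⟩

/-- **`R` is read off the multidegree** of `∂/∂x_{R,C} (S|T)` ("the `r₁` coordinate … is nonzero",
p0030:L96). [cite: AndrewsForbes2022, Prop. 5.3 (proof)] -/
theorem mem_iff_rowDeg_hasseIdx_ne_zero (B : Bitableau n m) (hρ₀ : ρ₀ ∈ B)
    (hr₀ : Function.Injective ρ₀.2.1) {k : ℕ} (AB : PairIdx ρ₀.1 k) (u : Fin ρ₀.1) :
    u ∈ AB.1.1 ↔ rowDeg (hasseIdx B (pairMatching ρ₀ AB)) (ρ₀.2.1 u) ≠ 0 := by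
  rw [rowDeg_hasseIdx_apply_ne_zero_iff, ← exists_fst_eq_iff hr₀ AB u]
  constructor
  · rintro ⟨q, hq, hq1⟩
    exact ⟨ρ₀, hρ₀, q, Finset.mem_inter.2 ⟨hq, pairMatching_subset_rowGrid AB hq⟩, hq1⟩
  · rintro ⟨ρ, -, q, hq, hq1⟩
    exact ⟨q, (Finset.mem_inter.1 hq).1, hq1⟩

/-- **`C` is read off the multidegree** of `∂/∂x_{R,C} (S|T)` ("The argument when `C ≠ C'` is
analogous", p0030:L99). [cite: AndrewsForbes2022, Prop. 5.3 (proof)] -/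
theorem mem_iff_colDeg_hasseIdx_ne_zero (B : Bitableau n m) (hρ₀ : ρ₀ ∈ B)
    (hc₀ : Function.Injective ρ₀.2.2) {k : ℕ} (AB : PairIdx ρ₀.1 k) (v : Fin ρ₀.1) :
    v ∈ AB.2.1 ↔ colDeg (hasseIdx B (pairMatching ρ₀ AB)) (ρ₀.2.2 v) ≠ 0 := by
  rw [colDeg_hasseIdx_apply_ne_zero_iff, ← exists_snd_eq_iff hc₀ AB v]
  constructor
  · rintro ⟨q, hq, hq1⟩
    exact ⟨ρ₀, hρ₀, q, Finset.mem_inter.2 ⟨hq, pairMatching_subset_rowGrid AB hq⟩, hq1⟩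
  · rintro ⟨ρ, -, q, hq, hq1⟩
    exact ⟨q, (Finset.mem_inter.1 hq).1, hq1⟩

/-- Two pair indices with the same subsets are equal (the order `k` is the common cardinality).
[cite: AndrewsForbes2022, Prop. 5.3 (proof)] -/
theorem sigma_pairIdx_ext {r N : ℕ} {i j : Σ k : Fin N, PairIdx r k}
    (hU : i.2.1.1 = j.2.1.1) (hV : i.2.2.1 = j.2.2.1) : i = j := by
  obtain ⟨ki, ⟨Ui, hUi⟩, ⟨Vi, hVi⟩⟩ := i
  obtain ⟨kj, ⟨Uj, hUj⟩, ⟨Vj, hVj⟩⟩ := j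
  dsimp only at hU hV
  subst hU hV
  have hk : ki = kj := Fin.ext (hUi.symm.trans hUj)
  subst hk
  rfl

/-- Nonzero polynomials with pairwise disjoint supports are linearly independent ("Polynomials of
differing multidegree are linearly independent", p0030:L101). [cite: AndrewsForbes2022, Prop. 5.3 (proof)] -/
theorem linearIndependent_of_support_disjoint {σ ι : Type*} (v : ι → MvPolynomial σ F)
    (hv : ∀ i, v i ≠ 0)
    (h : ∀ i j (μ : σ →₀ ℕ), μ ∈ (v i).support → μ ∈ (v j).support → i = j) :
    LinearIndependent F v := by
  classical
  rw [linearIndependent_iff']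
  intro s g hsum i hi
  obtain ⟨μ, hμ⟩ := MvPolynomial.ne_zero_iff.1 (hv i)
  have hc := congrArg (coeff μ) hsum
  rw [coeff_sum, coeff_zero, Finset.sum_eq_single_of_mem i hi] at hc
  · rw [coeff_smul, smul_eq_mul] at hc
    exact (mul_eq_zero.1 hc).resolve_right hμ
  · intro j hj hne
    rw [coeff_smul, smul_eq_mul]
    by_cases hj0 : coeff μ (v j) = 0
    · rw [hj0, mul_zero]
    · exact (hne (h j i μ (mem_support_iff.2 hj0) (mem_support_iff.2 hμ))).elim

/-- **The set `D` of Prop. 5.3 is linearly independent** (any characteristic): the derivatives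
`∂/∂x_{R,C} (S|T)`, `(R, C)` ranging over pairs of equinumerous subsets of the positions of a row of
`(S|T)` with distinct indices, are nonzero with pairwise distinct multidegrees.
[cite: AndrewsForbes2022, Prop. 5.3 (proof)] -/
theorem linearIndependent_hasseIdx_family (B : Bitableau n m) (hB0 : bideterminant F B ≠ 0)
    (hρ₀ : ρ₀ ∈ B) (N : ℕ) :
    LinearIndependent F fun i : Σ k : Fin N, PairIdx ρ₀.1 k =>
      mvHasseDeriv (hasseIdx B (pairMatching ρ₀ i.2)) (bideterminant F B) := by
  classical
  have hB := injective_of_bideterminant_ne_zero F B hB0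
  obtain ⟨hr₀, hc₀⟩ := hB ρ₀ hρ₀
  refine linearIndependent_of_support_disjoint F _ (fun i =>
    mvHasseDeriv_hasseIdx_bideterminant_ne_zero F B hB (pairMatching ρ₀ i.2)
      (injOn_fst_pairMatching hr₀ i.2) (injOn_snd_pairMatching hc₀ i.2)) ?_
  intro i j μ hi hj
  obtain ⟨hri, hci⟩ :=
    multideg_of_mem_support_bideterminant F B (add_mem_support_of_mem_support_mvHasseDeriv hi)
  obtain ⟨hrj, hcj⟩ :=
    multideg_of_mem_support_bideterminant F B (add_mem_support_of_mem_support_mvHasseDeriv hj)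
  rw [map_add] at hri hci hrj hcj
  have hr : rowDeg (hasseIdx B (pairMatching ρ₀ i.2)) = rowDeg (hasseIdx B (pairMatching ρ₀ j.2)) :=
    add_left_cancel (hri.trans hrj.symm)
  have hc : colDeg (hasseIdx B (pairMatching ρ₀ i.2)) = colDeg (hasseIdx B (pairMatching ρ₀ j.2)) :=
    add_left_cancel (hci.trans hcj.symm)
  apply sigma_pairIdx_ext
  · ext u
    rw [mem_iff_rowDeg_hasseIdx_ne_zero B hρ₀ hr₀ i.2 u, mem_iff_rowDeg_hasseIdx_ne_zero B hρ₀ hr₀ j.2 u,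
      hr]
  · ext v
    rw [mem_iff_colDeg_hasseIdx_ne_zero B hρ₀ hc₀ i.2 v, mem_iff_colDeg_hasseIdx_ne_zero B hρ₀ hc₀ j.2 v,
      hc]

/-- Each row's grid indicator is below the cap vector. [cite: AndrewsForbes2022, Lemma 5.1 (proof)] -/
theorem sqfree_rowGrid_le_cap (B : Bitableau n m) {ρ : BitableauRow n m} (hρ : ρ ∈ B) :
    sqfree (rowGrid ρ) ≤ cap B := by
  induction B with
  | nil => simp at hρ
  | cons ρ' B ih =>
    rw [cap_cons]
    rcases List.mem_cons.1 hρ with rfl | hρ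
    · exact le_self_add
    · exact (ih hρ).trans le_add_self

/-- For positions inside the chosen row every `dᵢ ≥ 1`, i.e. `𝟙_P ≤ Σₖ 𝟙_{P ∩ (S(k,•)×T(k,•))}`
("there are positive integers `d₁,…,d_ℓ`", Lemma 5.2). [cite: AndrewsForbes2022, Lemma 5.2] -/
theorem sqfree_pairMatching_le_hasseIdx (B : Bitableau n m) (hρ₀ : ρ₀ ∈ B) {k : ℕ}
    (AB : PairIdx ρ₀.1 k) :
    sqfree (pairMatching ρ₀ AB) ≤ hasseIdx B (pairMatching ρ₀ AB) := by
  classical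
  refine Finsupp.le_def.2 fun v => ?_
  by_cases hv : v ∈ pairMatching ρ₀ AB
  · rw [hasseIdx_apply_of_mem B hv]
    refine le_trans ?_ (Finsupp.le_def.1 (sqfree_rowGrid_le_cap B hρ₀) v)
    rw [sqfree_apply, sqfree_apply, if_pos hv, if_pos (pairMatching_subset_rowGrid AB hv)]
  · rw [sqfree_apply, if_neg hv]
    exact Nat.zero_le _

/-- **The set `D` of Prop. 5.3 in characteristic zero** (first-order mixed partials
`∏ᵢ ∂/∂x_{rᵢ,cᵢ} (S|T)`): linearly independent. [cite: AndrewsForbes2022, Prop. 5.3 (proof, char. 0)] -/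
theorem linearIndependent_sqfree_family [CharZero F] (B : Bitableau n m)
    (hB0 : bideterminant F B ≠ 0) (hρ₀ : ρ₀ ∈ B) (N : ℕ) :
    LinearIndependent F fun i : Σ k : Fin N, PairIdx ρ₀.1 k =>
      mvHasseDeriv (sqfree (pairMatching ρ₀ i.2)) (bideterminant F B) := by
  classical
  have hB := injective_of_bideterminant_ne_zero F B hB0
  obtain ⟨hr₀, hc₀⟩ := hB ρ₀ hρ₀
  refine linearIndependent_of_support_disjoint F _ (fun i =>
    mvHasseDeriv_sqfree_bideterminant_ne_zero F B hB (pairMatching ρ₀ i.2)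
      (injOn_fst_pairMatching hr₀ i.2) (injOn_snd_pairMatching hc₀ i.2)
      (sqfree_pairMatching_le_hasseIdx B hρ₀ i.2)) ?_
  intro i j μ hi hj
  obtain ⟨hri, hci⟩ :=
    multideg_of_mem_support_bideterminant F B (add_mem_support_of_mem_support_mvHasseDeriv hi)
  obtain ⟨hrj, hcj⟩ :=
    multideg_of_mem_support_bideterminant F B (add_mem_support_of_mem_support_mvHasseDeriv hj)
  rw [map_add] at hri hci hrj hcj
  have hr : rowDeg (sqfree (pairMatching ρ₀ i.2)) = rowDeg (sqfree (pairMatching ρ₀ j.2)) :=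
    add_left_cancel (hri.trans hrj.symm)
  have hc : colDeg (sqfree (pairMatching ρ₀ i.2)) = colDeg (sqfree (pairMatching ρ₀ j.2)) :=
    add_left_cancel (hci.trans hcj.symm)
  apply sigma_pairIdx_ext
  · ext u
    rw [← exists_fst_eq_iff hr₀ i.2 u, ← exists_fst_eq_iff hr₀ j.2 u,
      ← rowDeg_sqfree_apply_ne_zero_iff, ← rowDeg_sqfree_apply_ne_zero_iff, hr]
  · ext v
    rw [← exists_snd_eq_iff hc₀ i.2 v, ← exists_snd_eq_iff hc₀ j.2 v,
      ← colDeg_sqfree_apply_ne_zero_iff, ← colDeg_sqfree_apply_ne_zero_iff, hc]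

end Family

/-! ## Counting and the two discharges -/

section Count

/-- `|D| = Σᵢ binom(r,i)² = binom(2r,r)` (p0030:L62, Vandermonde `Nat.sum_range_choose_sq`).
[cite: AndrewsForbes2022, Prop. 5.3 (proof)] -/
theorem card_sigma_pairIdx (r : ℕ) :
    Fintype.card (Σ k : Fin (r + 1), PairIdx r k) = (2 * r).choose r := by
  rw [Fintype.card_sigma]
  simp_rw [Fintype.card_prod, Fintype.card_finset_len, Fintype.card_fin]
  rw [Fin.sum_univ_eq_sum_range (fun k => r.choose k * r.choose k) (r + 1),
    ← Nat.sum_range_choose_sq]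
  exact Finset.sum_congr rfl fun k _ => (sq _).symm

/-- The truncated count `Σ_{i ≤ min(r,d)} binom(r,i)²` of pairs of order `≤ d`.
[cite: AndrewsForbes2022, Prop. 5.3 (proof, char. 0)] -/
theorem card_sigma_pairIdx_le (r d : ℕ) :
    Fintype.card (Σ k : Fin (min r d + 1), PairIdx r k) =
      ∑ i ∈ Finset.range (min r d + 1), (r.choose i) ^ 2 := by
  rw [Fintype.card_sigma]
  simp_rw [Fintype.card_prod, Fintype.card_finset_len, Fintype.card_fin]
  rw [Fin.sum_univ_eq_sum_range (fun k => r.choose k * r.choose k) (min r d + 1)]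
  exact Finset.sum_congr rfl fun k _ => (sq _).symm

/-- `Σ_{i ≤ d} binom(r,i)² = Σ_{i ≤ min(r,d)} binom(r,i)²` (the terms `i > r` vanish).
[cite: AndrewsForbes2022, Prop. 5.3 (proof, char. 0)] -/
theorem sum_range_choose_sq_eq_min (r d : ℕ) :
    ∑ i ∈ Finset.range (d + 1), (r.choose i) ^ 2 =
      ∑ i ∈ Finset.range (min r d + 1), (r.choose i) ^ 2 := by
  rcases le_total d r with h | h
  · rw [min_eq_right h]
  · rw [min_eq_left h]
    symm
    refine Finset.sum_subset (Finset.range_subset_range.2 (by omega)) fun i hi hi' => ?_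
    rw [Finset.mem_range] at hi hi'
    rw [Nat.choose_eq_zero_of_lt (by omega), zero_pow two_ne_zero]

variable {F : Type*} [Field F] {n m : ℕ}

/-- A longest row exists when the width is positive. [cite: AndrewsForbes2022, Def. 2.23] -/
theorem exists_mem_fst_eq_width (B : Bitableau n m) (h : 0 < B.width) :
    ∃ ρ ∈ B, ρ.1 = B.width := by
  induction B with
  | nil => simp [Bitableau.width] at h
  | cons ρ B ih =>
    have hw : Bitableau.width (ρ :: B) = max ρ.1 (Bitableau.width B) := rfl
    rw [hw] at h ⊢
    rcases le_total (Bitableau.width B) ρ.1 with hle | hle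
    · exact ⟨ρ, List.mem_cons.2 (Or.inl rfl), (max_eq_left hle).symm⟩
    · rw [max_eq_right hle] at h ⊢
      obtain ⟨ρ', hρ', h'⟩ := ih h
      exact ⟨ρ', List.mem_cons.2 (Or.inr hρ'), h'⟩

/-- `f ∈ ∂_{<∞}(f)`. [cite: AndrewsForbes2022, Def. 2.19] -/
theorem self_mem_partialSpace {σ : Type*} (f : MvPolynomial σ F) : f ∈ partialSpace f :=
  Submodule.subset_span ⟨0, mvHasseDeriv_zero_left f⟩

/-- The order of the first-order mixed partial along `Q` is `|Q|`. [cite: AndrewsForbes2022, Def. 2.19] -/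
theorem degree_sqfree {σ : Type*} (Q : Finset σ) : Finsupp.degree (sqfree Q) = Q.card := by
  classical
  rw [sqfree, map_sum]
  simp [Finsupp.degree_single]

/-- **Discharge of `AndrewsForbes2022_prop_5_3`** (AF22 Prop. 5.3, first part, any characteristic;
p0030:L45): a nonzero bideterminant of width `r` has `dim ∂_{<∞}((S|T)) ≥ binom(2r,r)`.
[cite: AndrewsForbes2022, Prop. 5.3] -/
theorem AndrewsForbes2022_prop_5_3_holds : AndrewsForbes2022_prop_5_3 := by
  intro F _ n m B hB0
  classical
  haveI := finiteDimensional_partialSpace (bideterminant F B)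
  rcases Nat.eq_zero_or_pos B.width with h0 | hpos
  · rw [h0, Nat.choose_zero_right]
    exact Module.finrank_pos_iff_exists_ne_zero.2
      ⟨⟨bideterminant F B, self_mem_partialSpace _⟩, fun h => hB0 (congrArg Subtype.val h)⟩
  · obtain ⟨ρ₀, hρ₀, hw⟩ := exists_mem_fst_eq_width B hpos
    rw [← hw, ← card_sigma_pairIdx ρ₀.1]
    have hli := linearIndependent_hasseIdx_family F B hB0 hρ₀ (ρ₀.1 + 1)
    have hli' : LinearIndependent F (fun i : Σ k : Fin (ρ₀.1 + 1), PairIdx ρ₀.1 k =>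
        (⟨mvHasseDeriv (hasseIdx B (pairMatching ρ₀ i.2)) (bideterminant F B),
          Submodule.subset_span ⟨_, rfl⟩⟩ : partialSpace (bideterminant F B))) :=
      LinearIndependent.of_comp (partialSpace (bideterminant F B)).subtype hli
    exact hli'.fintype_card_le_finrank

/-- **Discharge of `AndrewsForbes2022_prop_5_3_charZero`** (AF22 Prop. 5.3, second part, `char F = 0`;
p0030:L47): `dim ∂_{≤d}((S|T)) ≥ Σ_{i=0}^{d} binom(r,i)²`. [cite: AndrewsForbes2022, Prop. 5.3] -/
theorem AndrewsForbes2022_prop_5_3_charZero_holds : AndrewsForbes2022_prop_5_3_charZero := by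
  intro F _ _ n m B hB0 d
  classical
  haveI := finiteDimensional_partialSpaceLE d (bideterminant F B)
  rcases Nat.eq_zero_or_pos B.width with h0 | hpos
  · rw [h0, Finset.sum_range_succ', Nat.choose_zero_right, one_pow, Finset.sum_eq_zero, zero_add]
    · exact Module.finrank_pos_iff_exists_ne_zero.2
        ⟨⟨bideterminant F B, self_mem_partialSpaceLE d _⟩, fun h => hB0 (congrArg Subtype.val h)⟩
    · intro i _
      rw [Nat.choose_zero_succ, zero_pow two_ne_zero]
  · obtain ⟨ρ₀, hρ₀, hw⟩ := exists_mem_fst_eq_width B hpos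
    obtain ⟨hr₀, -⟩ := injective_of_bideterminant_ne_zero F B hB0 ρ₀ hρ₀
    rw [← hw, sum_range_choose_sq_eq_min, ← card_sigma_pairIdx_le ρ₀.1 d]
    have hli := linearIndependent_sqfree_family F B hB0 hρ₀ (min ρ₀.1 d + 1)
    have hmem : ∀ i : Σ k : Fin (min ρ₀.1 d + 1), PairIdx ρ₀.1 k,
        mvHasseDeriv (sqfree (pairMatching ρ₀ i.2)) (bideterminant F B) ∈
          partialSpaceLE d (bideterminant F B) := by
      intro i
      refine Submodule.subset_span ⟨sqfree (pairMatching ρ₀ i.2), ?_, rfl⟩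
      show Finsupp.degree (sqfree (pairMatching ρ₀ i.2)) ≤ d
      rw [degree_sqfree, card_pairMatching hr₀ i.2]
      have := i.1.2
      omega
    have hli' : LinearIndependent F (fun i : Σ k : Fin (min ρ₀.1 d + 1), PairIdx ρ₀.1 k =>
        (⟨mvHasseDeriv (sqfree (pairMatching ρ₀ i.2)) (bideterminant F B), hmem i⟩ :
          partialSpaceLE d (bideterminant F B))) :=
      LinearIndependent.of_comp (partialSpaceLE d (bideterminant F B)).subtype hli
    exact hli'.fintype_card_le_finrank

end Count

end Literature.Computability.AlgebraicComplexity
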